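import Literature.AlgebraicGeometry.Motives.RigidTuples
import Literature.AlgebraicGeometry.Motives.MiddleConvolutionProofs
import Mathlib.LinearAlgebra.Eigenspace.Triangularizable
import Mathlib.LinearAlgebra.FreeModule.Finite.Matrix
import HarnessLib

/-!
# Local data of Katz's middle convolution: centralizer dimensions, `G_∞`, and
# [DettweilerReiter2000, Lemma 4.1 (a)]

This file supplies the linear algebra behind [DettweilerReiter2000, §4] (Katz's existence
algorithm, [Katz1996, Ch. 5–6]) in the tuple model of
`Literature.AlgebraicGeometry.Motives.MiddleConvolution` / `RigidTuples`; it is the first half of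
the proof of Katz's algorithm for tuples of index of rigidity `2`
(`Literature.AlgebraicGeometry.Motives.RigidTuplesProofs`).

* `RigidTuple.finrank_centralizer_eq_restrict_add_sq` (**peeling lemma**): for an endomorphism
  `U` of a finite-dimensional space, `dim C_V(U) = dim C_{im U}(U|_{im U}) + (dim ker U)²`
  (restriction `C_V(U) → C_{im U}(U|)` is onto with kernel `Hom(V/im U, ker U)`).  This replaces
  the Jordan-normal-form bookkeeping of [Katz1996, Ch. 6.0] / [DettweilerReiter2000, Cor. 4.2,
  Cor. 4.4] ("the proof in Katz (1996) depends only on numerical data of the Jordan canonical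
  forms"): iterating it over the eigenvalues gives Frobenius' `dim C(X) = Σ_β Σ_k e_k(β)²`, but we
  never need that formula.
* `RigidTuple.exists_finrank_centralizer_le_mul`: over an algebraically closed field,
  `dim C(X) ≤ n · dim ker(X − β)` for a suitable `β` — the estimate
  "`dim C(T_i) ≤ (n/(n − n_i))(n − n_i)²`" of [DettweilerReiter2000, proof of Thm. 4.9].
* `RigidTuple.finrank_centralizer_eq_of_conj`, `RigidTuple.centralizer_smul_add_smul_one`:
  transport of commutants along conjugation and affine rescaling.
* `MiddleConvolution.convolution_prodGenerators_apply` ([DettweilerReiter2000, Remark 2.3] in the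
  block convention of the tree, order of the index set reversed):
  `C_λ(ρ)(f_0 ⋯ f_m) v = λ v + (A_{j+1} ⋯ A_m u)_j`, `u = λ Σ_i (A_i − 1) v_i`; hence
  `MiddleConvolution.middleConvolution_prodGenerators_eq_smul_one`: if `λ ≠ 1` and `λ A_0⋯A_m = 1`
  then `MC_λ(ρ)(f_0 ⋯ f_m) = λ` ([DettweilerReiter2000, Lemma 4.1 (b)]: `rk(G_∞|MC − λ) =
  rk(λ A_∞ − 1) = 0`).
* `MiddleConvolution.exists_rangeEquiv_conj` ([DettweilerReiter2000, Lemma 4.1 (a)]): under `(∗)`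
  and `(∗∗)` at `(i, λ)`, `θ_i : im(A_i − 1) ≅ im(Ḡ_i − 1)`, `(A_i − 1)x ↦ [ι_i x]`, conjugating
  `λ A_i − 1` into `Ḡ_i − 1` (`Ḡ_i = B_i` on `MC_λ(V)`; the printed `φ_i` is `θ_i⁻¹`); with the
  peeling lemma, `MiddleConvolution.centralizerDim_middleConvolution_local`:
  `rk(Ḡ_i − 1) = rk(A_i − 1)` and `dim C(Ḡ_i) − (dim ker(Ḡ_i − 1))² = dim C(A_i) − (dim ker(A_i − 1))²`
  — the local input of [DettweilerReiter2000, Cor. 4.4] (index of rigidity is preserved).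

## References
* M. Dettweiler, S. Reiter, *An algorithm of Katz and its application to the inverse Galois
  problem*, J. Symbolic Comput. 30 (2000) 761–798, Remark 2.3, Lemma 4.1, Cor. 4.2, Cor. 4.4,
  Thm. 4.9 [DettweilerReiter2000].
* N. M. Katz, *Rigid Local Systems*, Annals of Math. Studies 139, 1996, Ch. 6 [Katz1996].
-/

noncomputable section

namespace Literature.AlgebraicGeometry.Motives

open MiddleConvolution Module

universe u v

namespace RigidTuple

section Centralizer

variable {K : Type*} [Field K] {V : Type*} [AddCommGroup V] [Module K V]

/-- Membership in the commutant `C(U) = {Y | U Y = Y U}` of a single endomorphism. [folklore] -/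
theorem mem_centralizer_singleton_iff (U Y : Module.End K V) :
    Y ∈ Subalgebra.centralizer K ({U} : Set (Module.End K V)) ↔ U * Y = Y * U := by
  rw [Subalgebra.mem_centralizer_iff]
  simp only [Set.mem_singleton_iff, forall_eq]

/-- `C(a U + b) = C(U)` for `a ≠ 0`: the commutant only sees `U` up to affine rescaling.
[folklore] -/
theorem centralizer_smul_add_smul_one {a : K} (ha : a ≠ 0) (b : K) (U : Module.End K V) :
    Subalgebra.centralizer K ({a • U + b • 1} : Set (Module.End K V)) =
      Subalgebra.centralizer K ({U} : Set (Module.End K V)) := by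
  ext Y
  rw [mem_centralizer_singleton_iff, mem_centralizer_singleton_iff, add_mul, mul_add,
    smul_mul_assoc, mul_smul_comm, smul_mul_assoc, mul_smul_comm, one_mul, mul_one]
  constructor
  · intro h
    have h2 : a • (U * Y) = a • (Y * U) := add_right_cancel h
    have h3 := congrArg (fun Z => a⁻¹ • Z) h2
    simpa only [smul_smul, inv_mul_cancel₀ ha, one_smul] using h3
  · intro h
    rw [h]

/-- `C(U - β) = C(U)`. [folklore] -/
theorem centralizer_sub_smul_one (β : K) (U : Module.End K V) :
    Subalgebra.centralizer K ({U - β • 1} : Set (Module.End K V)) =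
      Subalgebra.centralizer K ({U} : Set (Module.End K V)) := by
  have h := centralizer_smul_add_smul_one (one_ne_zero) (-β) U
  rwa [one_smul, neg_smul, ← sub_eq_add_neg] at h

/-- `C(c U) = C(U)` for `c ≠ 0`. [folklore] -/
theorem centralizer_smul {c : K} (hc : c ≠ 0) (U : Module.End K V) :
    Subalgebra.centralizer K ({c • U} : Set (Module.End K V)) =
      Subalgebra.centralizer K ({U} : Set (Module.End K V)) := by
  have h := centralizer_smul_add_smul_one hc 0 U
  rwa [zero_smul, add_zero] at h

/-- **Transport of commutants**: if `e : V ≃ W` conjugates `S` into `T` then `dim C(S) = dim C(T)`.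
[folklore] -/
theorem finrank_centralizer_eq_of_conj {W : Type*} [AddCommGroup W] [Module K W]
    (e : V ≃ₗ[K] W) (S : Module.End K V) (T : Module.End K W) (h : ∀ v, e (S v) = T (e v)) :
    finrank K (Subalgebra.centralizer K ({S} : Set (Module.End K V))) =
      finrank K (Subalgebra.centralizer K ({T} : Set (Module.End K W))) := by
  have hT : T = e.conj S := by
    ext w
    rw [LinearEquiv.conj_apply_apply, h, LinearEquiv.apply_symm_apply]
  have hmap : Submodule.map (e.conj : Module.End K V ≃ₗ[K] Module.End K W).toLinearMap
      (Subalgebra.toSubmodule (Subalgebra.centralizer K ({S} : Set (Module.End K V)))) =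
        Subalgebra.toSubmodule (Subalgebra.centralizer K ({T} : Set (Module.End K W))) := by
    ext Y'
    simp only [Submodule.mem_map, Subalgebra.mem_toSubmodule, mem_centralizer_singleton_iff,
      LinearEquiv.coe_coe]
    constructor
    · rintro ⟨Y, hY, rfl⟩
      rw [hT, Module.End.mul_eq_comp, Module.End.mul_eq_comp, ← LinearEquiv.conj_comp,
        ← LinearEquiv.conj_comp, ← Module.End.mul_eq_comp, ← Module.End.mul_eq_comp, hY]
    · intro hY'
      refine ⟨e.symm.conj Y', ?_, LinearEquiv.conj_conj_symm e Y'⟩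
      have hS : S = e.symm.conj T := by rw [hT, LinearEquiv.conj_symm_conj]
      rw [hS, Module.End.mul_eq_comp, Module.End.mul_eq_comp, ← LinearEquiv.conj_comp,
        ← LinearEquiv.conj_comp, ← Module.End.mul_eq_comp, ← Module.End.mul_eq_comp, hY']
  rw [← Subalgebra.finrank_toSubmodule, ← Subalgebra.finrank_toSubmodule, ← hmap]
  exact (LinearEquiv.finrank_map_eq _ _).symm

/-- An element of `C(U)` preserves `im U`. [folklore] -/
theorem apply_mem_range_of_mem_centralizer {U Y : Module.End K V}
    (hY : Y ∈ Subalgebra.centralizer K ({U} : Set (Module.End K V))) {x : V}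
    (hx : x ∈ LinearMap.range U) : Y x ∈ LinearMap.range U := by
  obtain ⟨v, rfl⟩ := LinearMap.mem_range.1 hx
  rw [mem_centralizer_singleton_iff] at hY
  refine ⟨Y v, ?_⟩
  rw [← Module.End.mul_apply, hY, Module.End.mul_apply]

/-- **Peeling lemma** for commutant dimensions: for an endomorphism `U` of a finite-dimensional
space, restriction to the `U`-stable subspace `im U` maps `C_V(U)` ONTO `C_{im U}(U|)` with kernel
`Hom(V/im U, ker U)`, so `dim C_V(U) = dim C_{im U}(U|_{im U}) + (dim ker U)²`.  (Iterated over the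
eigenvalues this yields Frobenius' formula `dim C(X) = Σ_β Σ_k e_k(β)²`, which is how
[DettweilerReiter2000, proof of Cor. 4.4] / [Katz1996, Ch. 6.0] use Jordan forms; the lemma lets us
avoid Jordan normal forms altogether.) [folklore] -/
theorem finrank_centralizer_eq_restrict_add_sq [FiniteDimensional K V] (U : Module.End K V) :
    finrank K (Subalgebra.centralizer K ({U} : Set (Module.End K V))) =
      finrank K (Subalgebra.centralizer K
        ({U.restrict (p := LinearMap.range U) (q := LinearMap.range U)
            fun x _ => LinearMap.mem_range_self U x} :
          Set (Module.End K (LinearMap.range U)))) +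
        finrank K (LinearMap.ker U) ^ 2 := by
  set I : Submodule K V := LinearMap.range U with hI
  set UI : Module.End K I := U.restrict (p := I) (q := I) fun x _ => LinearMap.mem_range_self U x
    with hUI
  set C := Subalgebra.toSubmodule (Subalgebra.centralizer K ({U} : Set (Module.End K V))) with hC
  set CI := Subalgebra.toSubmodule (Subalgebra.centralizer K ({UI} : Set (Module.End K I))) with hCI
  obtain ⟨S, hS⟩ := I.exists_isCompl
  set π : V →ₗ[K] I := I.projectionOnto S hS with hπ
  -- the restriction map `Y ↦ π ∘ Y ∘ incl`, linear on all of `End V`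
  set R : Module.End K V →ₗ[K] Module.End K I :=
    (LinearMap.llcomp K I V I π).comp (LinearMap.lcomp K V I.subtype) with hR
  have hRapply : ∀ (Y : Module.End K V) (x : I), R Y x = π (Y x) := fun Y x => rfl
  have hpres : ∀ Y ∈ C, ∀ x ∈ I, Y x ∈ I := fun Y hY x hx =>
    apply_mem_range_of_mem_centralizer hY hx
  have hRY : ∀ Y ∈ C, ∀ x : I, (R Y x : V) = Y x := by
    intro Y hY x
    rw [hRapply, Submodule.projectionOnto_apply_of_mem_left hS (hpres Y hY x x.2)]
  set res : C →ₗ[K] Module.End K I := R.comp C.subtype with hres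
  have hresapply : ∀ Y : C, res Y = R (Y : Module.End K V) := fun Y => rfl
  have h1 := LinearMap.finrank_range_add_finrank_ker res
  -- (1) the range of `res` is `C_I(U|)`
  have hUIcoe : ∀ x : I, (UI x : V) = U x := fun x => rfl
  have hrange : LinearMap.range res = CI := by
    apply le_antisymm
    · rintro _ ⟨Y, rfl⟩
      rw [hCI, Subalgebra.mem_toSubmodule, mem_centralizer_singleton_iff, hresapply]
      have hYC : (Y : Module.End K V) ∈ C := Y.2
      have hY := (mem_centralizer_singleton_iff U Y).1 hYC
      refine LinearMap.ext fun x => Subtype.ext ?_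
      rw [Module.End.mul_apply, Module.End.mul_apply, hUIcoe, hRY _ hYC, hRY _ hYC, hUIcoe,
        ← Module.End.mul_apply, hY, Module.End.mul_apply]
    · intro Z hZ
      rw [hCI, Subalgebra.mem_toSubmodule, mem_centralizer_singleton_iff] at hZ
      obtain ⟨σ, hσ⟩ := (U.rangeRestrict).exists_rightInverse_of_surjective
        (LinearMap.range_rangeRestrict U)
      have hσ' : ∀ i : I, U (σ i) = i := fun i => by
        have := LinearMap.congr_fun hσ i
        exact congrArg Subtype.val this
      set Q : Module.End K V := LinearMap.id - I.subtype ∘ₗ π with hQ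
      set Y : Module.End K V := I.subtype ∘ₗ Z ∘ₗ π + σ ∘ₗ Z ∘ₗ U.rangeRestrict ∘ₗ Q with hYdef
      have hYapply : ∀ v, Y v = (Z (π v) : V) + σ (Z (U.rangeRestrict (v - π v))) := fun v => rfl
      have hYU : ∀ v, Y (U v) = Z ⟨U v, LinearMap.mem_range_self U v⟩ := by
        intro v
        rw [hYapply, Submodule.projectionOnto_apply_of_mem_left hS (LinearMap.mem_range_self U v),
          sub_self, map_zero, map_zero, map_zero, add_zero]
      have hYC : Y ∈ C := by
        rw [hC, Subalgebra.mem_toSubmodule, mem_centralizer_singleton_iff]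
        refine LinearMap.ext fun v => ?_
        rw [Module.End.mul_apply, Module.End.mul_apply, hYU, hYapply, _root_.map_add, hσ']
        have h2 : U (Z (π v) : V) = (UI (Z (π v)) : V) := rfl
        rw [h2, ← Module.End.mul_apply, hZ, Module.End.mul_apply, ← Submodule.coe_add,
          ← _root_.map_add]
        congr 2
        apply Subtype.ext
        rw [Submodule.coe_add, hUIcoe, LinearMap.codRestrict_apply, map_sub, add_sub_cancel]
      refine ⟨⟨Y, hYC⟩, ?_⟩
      rw [hresapply]
      refine LinearMap.ext fun x => Subtype.ext ?_
      rw [hRY _ hYC, hYapply, Submodule.projectionOnto_apply_left hS, sub_self, map_zero, map_zero,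
        map_zero, add_zero]
  -- (2) the kernel of `res` is `Hom(V / I, ker U)`
  set Φ : ((V ⧸ I) →ₗ[K] LinearMap.ker U) →ₗ[K] Module.End K V :=
    (LinearMap.lcomp K V I.mkQ).comp
      (LinearMap.llcomp K (V ⧸ I) (LinearMap.ker U) V (LinearMap.ker U).subtype) with hΦ
  have hΦapply : ∀ (T : (V ⧸ I) →ₗ[K] LinearMap.ker U) (v : V),
      Φ T v = (T (Submodule.Quotient.mk v) : V) := fun T v => rfl
  have hΦinj : Function.Injective Φ := by
    intro T T' hTT'
    refine LinearMap.ext fun q => ?_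
    obtain ⟨v, rfl⟩ := Submodule.Quotient.mk_surjective I q
    apply Subtype.ext
    rw [← hΦapply, ← hΦapply, hTT']
  have hker : Submodule.map C.subtype (LinearMap.ker res) = LinearMap.range Φ := by
    apply le_antisymm
    · rintro _ ⟨Y, hY, rfl⟩
      have hYC : (Y : Module.End K V) ∈ C := Y.2
      rw [SetLike.mem_coe, LinearMap.mem_ker, hresapply] at hY
      -- `Y` vanishes on `I`
      have hY0 : ∀ x ∈ I, (Y : Module.End K V) x = 0 := by
        intro x hx
        have := congrArg (fun f : Module.End K I => (f ⟨x, hx⟩ : V)) hY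
        simpa only [hRY _ hYC, LinearMap.zero_apply, Submodule.coe_zero] using this
      have hYker : ∀ v, (Y : Module.End K V) v ∈ LinearMap.ker U := by
        intro v
        rw [LinearMap.mem_ker, ← Module.End.mul_apply,
          (mem_centralizer_singleton_iff U _).1 hYC, Module.End.mul_apply]
        exact hY0 _ (LinearMap.mem_range_self U v)
      have hle : I ≤ LinearMap.ker (LinearMap.codRestrict (LinearMap.ker U) (Y : Module.End K V)
          hYker) := fun x hx => by
        rw [LinearMap.mem_ker]
        exact Subtype.ext (hY0 x hx)
      refine ⟨I.liftQ _ hle, LinearMap.ext fun v => ?_⟩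
      rw [hΦapply]
      rfl
    · rintro _ ⟨T, rfl⟩
      have hTU : ∀ v, U (Φ T v) = 0 := fun v => by
        rw [hΦapply]
        exact (T _).2
      have hUT : ∀ v, Φ T (U v) = 0 := fun v => by
        rw [hΦapply, (Submodule.Quotient.mk_eq_zero I).2 (LinearMap.mem_range_self U v), map_zero,
          Submodule.coe_zero]
      have hTC : Φ T ∈ C := by
        rw [hC, Subalgebra.mem_toSubmodule, mem_centralizer_singleton_iff]
        refine LinearMap.ext fun v => ?_
        rw [Module.End.mul_apply, Module.End.mul_apply, hTU, hUT]
      refine ⟨⟨Φ T, hTC⟩, ?_, rfl⟩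
      rw [SetLike.mem_coe, LinearMap.mem_ker, hresapply]
      refine LinearMap.ext fun x => Subtype.ext ?_
      rw [hRY _ hTC, LinearMap.zero_apply, Submodule.coe_zero]
      obtain ⟨v, hv⟩ := LinearMap.mem_range.1 x.2
      rw [← hv, hUT]
  have hkerdim : finrank K (LinearMap.ker res) = finrank K (LinearMap.ker U) ^ 2 := by
    rw [← Submodule.finrank_map_subtype_eq C (LinearMap.ker res), hker,
      LinearMap.finrank_range_of_inj hΦinj, Module.finrank_linearMap, sq]
    congr 1
    have h2 := I.finrank_quotient_add_finrank
    have h3 := LinearMap.finrank_range_add_finrank_ker U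
    rw [← hI] at h3
    omega
  rw [← Subalgebra.finrank_toSubmodule, ← Subalgebra.finrank_toSubmodule, ← hC, ← hCI, ← h1, hrange,
    hkerdim]

/-- In dimension zero every commutant is zero-dimensional. [folklore] -/
theorem finrank_centralizer_eq_zero_of_finrank_eq_zero [FiniteDimensional K V]
    (h : finrank K V = 0) (X : Module.End K V) :
    finrank K (Subalgebra.centralizer K ({X} : Set (Module.End K V))) = 0 := by
  haveI : Subsingleton V := Module.finrank_zero_iff.1 h
  haveI : Subsingleton (Module.End K V) := inferInstance
  haveI : Subsingleton (Subalgebra.centralizer K ({X} : Set (Module.End K V))) :=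
    ⟨fun a b => Subtype.ext (Subsingleton.elim _ _)⟩
  exact Module.finrank_zero_of_subsingleton

/-- **Commutant bound** ([DettweilerReiter2000, proof of Thm. 4.9]: "`dim C(T_i) ≤
(n/(n − n_i))·(n − n_i)²`", `n − n_i` the largest eigenspace dimension): over an algebraically
closed field, for every endomorphism `X` of an `n`-dimensional space, `n ≥ 1`, some `β` satisfies
`dim C(X) ≤ n · dim ker(X − β)`.  Proof by the peeling lemma and induction on `n` (no Jordan forms).
[cite: DettweilerReiter2000, Theorem 4.9] -/
theorem exists_finrank_centralizer_le_mul [IsAlgClosed K] (n : ℕ) :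
    ∀ (W : Type v) [AddCommGroup W] [Module K W] [FiniteDimensional K W],
      finrank K W = n → 0 < n → ∀ X : Module.End K W,
        ∃ β : K, finrank K (Subalgebra.centralizer K ({X} : Set (Module.End K W))) ≤
          n * finrank K (LinearMap.ker (X - β • 1)) := by
  induction n using Nat.strong_induction_on with
  | _ n ih =>
  intro W _ _ _ hn hpos X
  haveI : Nontrivial W := Module.nontrivial_of_finrank_pos (hn ▸ hpos)
  obtain ⟨β₀, hβ₀⟩ := Module.End.exists_eigenvalue X
  set U : Module.End K W := X - β₀ • 1 with hU
  have hkerU : LinearMap.ker U ≠ ⊥ := by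
    rw [hU, ← Module.End.eigenspace_def]
    exact Module.End.hasEigenvalue_iff.1 hβ₀
  have hd : 0 < finrank K (LinearMap.ker U) := by
    refine Nat.pos_of_ne_zero fun h0 => hkerU ?_
    exact Submodule.finrank_eq_zero.1 h0
  have hcX : Subalgebra.centralizer K ({X} : Set (Module.End K W)) =
      Subalgebra.centralizer K ({U} : Set (Module.End K W)) := (centralizer_sub_smul_one β₀ X).symm
  have hpeel := finrank_centralizer_eq_restrict_add_sq U
  have hrk := LinearMap.finrank_range_add_finrank_ker U
  set I : Submodule K W := LinearMap.range U with hI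
  set UI : Module.End K I := U.restrict (p := I) (q := I) fun x _ => LinearMap.mem_range_self U x
    with hUI
  rw [hcX, hpeel]
  by_cases hI0 : finrank K I = 0
  · refine ⟨β₀, ?_⟩
    rw [finrank_centralizer_eq_zero_of_finrank_eq_zero hI0 UI, zero_add, ← hU]
    have hdn : finrank K (LinearMap.ker U) = n := by omega
    rw [hdn, sq]
  · have hIlt : finrank K I < n := by omega
    obtain ⟨β', hβ'⟩ := ih (finrank K I) hIlt I rfl (Nat.pos_of_ne_zero hI0) UI
    -- `ker(U| − β') ↪ ker(X − (β₀ + β'))`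
    have hmem : ∀ x : LinearMap.ker (UI - β' • 1),
        ((x : I) : W) ∈ LinearMap.ker (X - (β₀ + β') • 1) := by
      intro x
      have hx := x.2
      rw [LinearMap.mem_ker] at hx ⊢
      have hx' := congrArg Subtype.val hx
      simp only [LinearMap.sub_apply, LinearMap.smul_apply, Module.End.one_apply, Submodule.coe_sub,
        Submodule.coe_smul, LinearMap.coe_restrict_apply, Submodule.coe_zero, hUI, hU] at hx'
      rw [LinearMap.sub_apply, LinearMap.smul_apply, Module.End.one_apply, add_smul, ← sub_sub]
      exact hx'
    have hk : finrank K (LinearMap.ker (UI - β' • 1)) ≤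
        finrank K (LinearMap.ker (X - (β₀ + β') • 1)) := by
      refine LinearMap.finrank_le_finrank_of_injective
        (f := LinearMap.codRestrict _ (I.subtype ∘ₗ (LinearMap.ker (UI - β' • 1)).subtype)
          fun x => hmem x) fun x y hxy => ?_
      have := congrArg Subtype.val hxy
      simp only [LinearMap.codRestrict_apply, LinearMap.comp_apply, Submodule.subtype_apply] at this
      exact Subtype.ext (Subtype.ext this)
    by_cases hdk : finrank K (LinearMap.ker U) ≤ finrank K (LinearMap.ker (X - (β₀ + β') • 1))
    · refine ⟨β₀ + β', ?_⟩
      nlinarith [Nat.mul_le_mul_left (finrank K I) (hβ'.trans' le_rfl), hβ',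
        Nat.mul_le_mul_left (finrank K I) hk, Nat.mul_le_mul_left (finrank K (LinearMap.ker U)) hdk]
    · refine ⟨β₀, ?_⟩
      rw [← hU]
      rw [not_le] at hdk
      nlinarith [hβ', Nat.mul_le_mul_left (finrank K I) hk,
        Nat.mul_le_mul_left (finrank K I) hdk.le]

end Centralizer

end RigidTuple

/-! ### The monodromy at infinity of the convolution ([DettweilerReiter2000, Remark 2.3]) -/

namespace MiddleConvolution

open RigidTuple

section ProductFormula

variable {K : Type*} [CommRing K] {V : Type*} [AddCommGroup V] [Module K V]

omit [Module K V] in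
/-- A telescoping sum written with an indicator. [folklore] -/
theorem sum_range_ite_sub_eq (P : ℕ → V) (k N : ℕ) :
    ∑ t ∈ Finset.range N, (if k < t then P t - P (t + 1) else 0) =
      if k < N then P (k + 1) - P N else 0 := by
  induction N with
  | zero => simp
  | succ N ih =>
    rw [Finset.sum_range_succ, ih]
    by_cases h1 : k < N
    · rw [if_pos h1, if_pos h1, if_pos (Nat.lt_succ_of_lt h1)]
      abel
    · by_cases h3 : k = N
      · subst h3
        rw [if_neg h1, if_neg (lt_irrefl k), if_pos (Nat.lt_succ_self k), sub_self, add_zero]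
      · have h4 : ¬ k < N + 1 := by omega
        rw [if_neg h1, if_neg h1, if_neg h4, add_zero]

variable {m : ℕ} (ρ : Representation K (FreeGroup (Fin (m + 1))) V) (l : Kˣ)

/-- `A_j (A_{j+1} ⋯ A_m u) = A_j ⋯ A_m u`. [folklore] -/
theorem tuple_apply_suffixProd_succ (j : Fin (m + 1)) (u : V) :
    tuple ρ j (ρ (suffixProd (m + 1) ((j : ℕ) + 1)) u) = ρ (suffixProd (m + 1) j) u := by
  rw [tuple, ← Module.End.mul_apply, ← map_mul, ← suffixProd_eq_of_mul]

/-- **Partial products of the convolution operators** (the computation behind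
[DettweilerReiter2000, Remark 2.3], in the block convention of the tree): for `k ≤ m + 1`,
`(B_k B_{k+1} ⋯ B_m v)_j = v_j` for `j < k` and `= λ v_j + A_{j+1} ⋯ A_m u` for `j ≥ k`, where
`u = λ Σ_i (A_i − 1) v_i`. [cite: DettweilerReiter2000, Remark 2.3] -/
theorem convolution_suffixProd_apply (d : ℕ) :
    ∀ k : ℕ, k + d = m + 1 → ∀ v : Fin (m + 1) → V,
      convolution ρ l (suffixProd (m + 1) k) v = fun j : Fin (m + 1) =>
        if (j : ℕ) < k then v j
        else (l : K) • v j +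
          ρ (suffixProd (m + 1) ((j : ℕ) + 1)) ((l : K) • ∑ i, (ρ (FreeGroup.of i) (v i) - v i)) := by
  induction d with
  | zero =>
    intro k hk v
    rw [add_zero] at hk
    rw [hk, suffixProd_of_le le_rfl, map_one, Module.End.one_apply]
    funext j
    rw [if_pos j.is_lt]
  | succ d ih =>
    intro k hk v
    have hkm : k < m + 1 := by omega
    set kf : Fin (m + 1) := ⟨k, hkm⟩ with hkf
    have hsp : suffixProd (m + 1) k = FreeGroup.of kf * suffixProd (m + 1) (k + 1) :=
      suffixProd_eq_of_mul (m + 1) kf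
    rw [hsp, map_mul, Module.End.mul_apply, ih (k + 1) (by omega) v, convolution_of,
      convolutionEnd_apply]
    set u : V := (l : K) • ∑ i, (ρ (FreeGroup.of i) (v i) - v i) with hu
    set w : Fin (m + 1) → V := fun j => if (j : ℕ) < k + 1 then v j
      else (l : K) • v j + ρ (suffixProd (m + 1) ((j : ℕ) + 1)) u with hw
    funext j
    rcases eq_or_ne j kf with rfl | hjk
    · rw [Function.update_self, if_neg (lt_irrefl _)]
      -- the off-diagonal terms
      have hterm : ∀ j ∈ Finset.univ.erase kf, coeff (tuple ρ) (l : K) kf j (w j) =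
          (l : K) • (ρ (FreeGroup.of j) (v j) - v j) +
            (if (kf : ℕ) < j then
              ρ (suffixProd (m + 1) j) u - ρ (suffixProd (m + 1) ((j : ℕ) + 1)) u else 0) := by
        intro j hj
        have hne : j ≠ kf := Finset.ne_of_mem_erase hj
        unfold coeff
        by_cases hlt : j < kf
        · have hlt' : (j : ℕ) < k + 1 := Nat.lt_succ_of_lt hlt
          have hwj : w j = v j := if_pos hlt'
          have hnot : ¬ ((kf : ℕ) < j) := fun h => lt_asymm hlt h
          rw [if_pos hlt, hwj, if_neg hnot, add_zero, LinearMap.smul_apply, LinearMap.sub_apply,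
            Module.End.one_apply]
        · have hgt : kf < j := lt_of_le_of_ne (not_lt.1 hlt) hne.symm
          have hgt' : (kf : ℕ) < j := hgt
          have hnlt : ¬ ((j : ℕ) < k + 1) := by
            change k < (j : ℕ) at hgt'
            omega
          have hwj : w j = (l : K) • v j + ρ (suffixProd (m + 1) ((j : ℕ) + 1)) u := if_neg hnlt
          rw [if_neg hlt, hwj, if_pos hgt', LinearMap.sub_apply, Module.End.one_apply, _root_.map_add,
            map_smul, ← tuple_apply_suffixProd_succ ρ j u]
          simp only [smul_sub]
          abel
      rw [offDiag_apply, Finset.sum_congr rfl hterm, Finset.sum_add_distrib,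
        Finset.sum_erase_eq_sub (Finset.mem_univ kf), Finset.sum_erase _ (by
          simp only [lt_self_iff_false, if_false]),
        if_pos (show ((kf : Fin (m + 1)) : ℕ) < k + 1 from Nat.lt_succ_self _)]
      -- the telescoping sum over `j > k`
      have htel : ∑ j : Fin (m + 1), (if (kf : ℕ) < j then
          ρ (suffixProd (m + 1) j) u - ρ (suffixProd (m + 1) ((j : ℕ) + 1)) u else 0) =
            ρ (suffixProd (m + 1) (k + 1)) u - u := by
        rw [Fin.sum_univ_eq_sum_range (fun t => if k < t then
          ρ (suffixProd (m + 1) t) u - ρ (suffixProd (m + 1) (t + 1)) u else 0) (m + 1),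
          sum_range_ite_sub_eq, if_pos hkm, suffixProd_of_le le_rfl, map_one, Module.End.one_apply]
      rw [htel, ← Finset.smul_sum, ← hu, smul_sub]
      have hkk : ρ (suffixProd (m + 1) ((kf : ℕ) + 1)) u = ρ (suffixProd (m + 1) (k + 1)) u := rfl
      rw [hkk]
      simp only [tuple]
      abel
    · rw [Function.update_of_ne hjk]
      have hne : (j : ℕ) ≠ k := fun h => hjk (Fin.ext h)
      by_cases hlt : (j : ℕ) < k
      · have hlt' : (j : ℕ) < k + 1 := Nat.lt_succ_of_lt hlt
        rw [if_pos hlt]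
        exact if_pos hlt'
      · have hnlt : ¬ ((j : ℕ) < k + 1) := by omega
        rw [if_neg hlt]
        exact if_neg hnlt

/-- **The product `B_0 ⋯ B_m` of the convolution operators** ([DettweilerReiter2000, Remark 2.3]
in the tree convention): `C_λ(ρ)(f_0 ⋯ f_m) v = λ v + (A_{j+1} ⋯ A_m u)_j` with
`u = λ Σ_i (A_i − 1) v_i`, i.e. `G_∞ − λ = diag(…, A_{j+1}⋯A_m, …) ∘ (rows λ(A_i − 1))`.
[cite: DettweilerReiter2000, Remark 2.3] -/
theorem convolution_prodGenerators_apply (v : Fin (m + 1) → V) :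
    convolution ρ l (prodGenerators (m + 1)) v =
      (l : K) • v + suffixVec ρ ((l : K) • ∑ i, (ρ (FreeGroup.of i) (v i) - v i)) := by
  rw [← suffixProd_zero, convolution_suffixProd_apply ρ l (m + 1) 0 (zero_add _) v]
  funext j
  rw [if_neg (Nat.not_lt_zero _)]
  rfl

/-- **`MC_λ(T)_∞ = λ` when `λ T_∞ = 1`** ([DettweilerReiter2000, Lemma 4.1 (b) with Remark 2.3]:
`rk(G_∞|MC − λ) = rk(λ A_∞ − 1) = 0`): if `λ ≠ 1` (here: `λ − 1` a unit) and `λ · A_0 ⋯ A_m = 1`,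
then `f_0 ⋯ f_m` acts on `MC_λ(ρ)` as the scalar `λ`, because `(G_∞ − λ) v ∈ ℒ` for every `v`.
[cite: DettweilerReiter2000, Lemma 4.1] -/
theorem middleConvolution_prodGenerators_eq_smul_one (hl : IsUnit ((l : K) - 1))
    (h1 : (l : K) • ρ (prodGenerators (m + 1)) = 1) :
    middleConvolution ρ l (prodGenerators (m + 1)) = (l : K) • (1 : Module.End K (Space ρ l)) := by
  refine LinearMap.ext fun x => ?_
  obtain ⟨v, rfl⟩ := Submodule.Quotient.mk_surjective _ x
  set u : V := (l : K) • ∑ i, (ρ (FreeGroup.of i) (v i) - v i) with hu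
  have hL : suffixVec ρ u ∈ (convolution ρ l).invariants := by
    rw [mem_invariants_convolution_iff_eq_suffixVec ρ l hl, suffixVec_last]
    exact ⟨rfl, by rw [← LinearMap.smul_apply, h1, Module.End.one_apply]⟩
  rw [middleConvolution_mk, convolution_prodGenerators_apply, ← hu, Submodule.Quotient.mk_add,
    (Submodule.Quotient.mk_eq_zero _).2 (show suffixVec ρ u ∈ kerSum ρ l from
      Submodule.mem_sup_right hL), add_zero,
    Submodule.Quotient.mk_smul, LinearMap.smul_apply, Module.End.one_apply]

end ProductFormula


/-! ### Local structure of `MC_λ` ([DettweilerReiter2000, Lemma 4.1 (a)]) -/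

section LocalStructure

variable {K : Type*} [Field K] {V : Type*} [AddCommGroup V] [Module K V]
variable {ι : Type*} [Fintype ι] [LinearOrder ι]

omit [Fintype ι] [LinearOrder ι] in
/-- `λ A − 1` preserves `im(A − 1)`. [folklore] -/
theorem smul_sub_one_apply_mem_range (A : Module.End K V) (c : K) {x : V}
    (hx : x ∈ LinearMap.range (A - 1)) : (c • A - 1) x ∈ LinearMap.range (A - 1) := by
  obtain ⟨z, rfl⟩ := LinearMap.mem_range.1 hx
  refine ⟨(c • A - 1) z, ?_⟩
  simp only [LinearMap.sub_apply, LinearMap.smul_apply, Module.End.one_apply, map_sub, map_smul,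
    smul_sub]
  abel

variable (ρ : Representation K (FreeGroup ι) V) (l : Kˣ) (i : ι)

/-- **[DettweilerReiter2000, Lemma 4.1 (a)] in the tree model.**  Under `(∗)` and `(∗∗)` at
`(i, λ)`, the map `θ_i : im(A_i − 1) → MC_λ(V)`, `(A_i − 1) x ↦ [ι_i x]`, is a linear isomorphism
onto `im(Ḡ_i − 1)` (`Ḡ_i = B_i` on `MC_λ(V)`), and it intertwines `λ A_i − 1` on `im(A_i − 1)`
with `Ḡ_i − 1` on `im(Ḡ_i − 1)` (the printed `φ_i` is `θ_i⁻¹`: "`φ_i ∘ G_i = λ A_i ∘ φ_i`").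
[cite: DettweilerReiter2000, Lemma 4.1] -/
theorem exists_rangeEquiv_conj
    (hS : (⨅ j ∈ {j | j ≠ i}, LinearMap.ker (tuple ρ j - 1)) ⊓
      LinearMap.ker ((l : K) • tuple ρ i - 1) = ⊥)
    (hSS : (⨆ j ∈ {j | j ≠ i}, LinearMap.range (tuple ρ j - 1)) ⊔
      LinearMap.range ((l : K) • tuple ρ i - 1) = ⊤) :
    ∃ θ : LinearMap.range (tuple ρ i - 1) ≃ₗ[K]
        LinearMap.range (middleConvolution ρ l (FreeGroup.of i) - 1),
      ∀ y : LinearMap.range (tuple ρ i - 1),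
        θ (((l : K) • tuple ρ i - 1).restrict
            (fun _ hx => smul_sub_one_apply_mem_range (tuple ρ i) (l : K) hx) y) =
          (middleConvolution ρ l (FreeGroup.of i) - 1).restrict
            (fun x _ => LinearMap.mem_range_self _ x) (θ y) := by
  set U : Module.End K V := tuple ρ i - 1 with hU
  set U' : Module.End K (Space ρ l) := middleConvolution ρ l (FreeGroup.of i) - 1 with hU'
  -- `s x = [ι_i x]`
  set s : V →ₗ[K] Space ρ l := (kerSum ρ l).mkQ ∘ₗ LinearMap.single K (fun _ : ι => V) i with hs
  have hsapply : ∀ x, s x = Submodule.Quotient.mk (Pi.single i x) := fun x => rfl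
  have hkers : ∀ x, s x = 0 ↔ U x = 0 := by
    intro x
    rw [hsapply, Submodule.Quotient.mk_eq_zero, single_mem_kerSum_iff ρ l hS, hU,
      LinearMap.sub_apply, Module.End.one_apply, sub_eq_zero]
  have hle : LinearMap.ker U ≤ LinearMap.ker s := fun x hx => by
    rw [LinearMap.mem_ker] at hx ⊢
    exact (hkers x).2 hx
  -- `U' [w] = [ι_i (D_i w)] = s (D_i w)`
  have hU'mk : ∀ w : ι → V, U' (Submodule.Quotient.mk w) = s (defect (tuple ρ) (l : K) w i) := by
    intro w
    rw [hU', LinearMap.sub_apply, Module.End.one_apply, middleConvolution_of_mk,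
      ← Submodule.Quotient.mk_sub, convolutionEnd_sub_self, hsapply]
  set θ₀ : LinearMap.range U →ₗ[K] Space ρ l :=
    ((LinearMap.ker U).liftQ s hle).comp U.quotKerEquivRange.symm.toLinearMap with hθ₀
  have hθ₀U : ∀ x : V, θ₀ ⟨U x, LinearMap.mem_range_self U x⟩ = s x := by
    intro x
    rw [hθ₀, LinearMap.comp_apply, LinearEquiv.coe_toLinearMap,
      LinearMap.quotKerEquivRange_symm_apply_image, Submodule.mkQ_apply, Submodule.liftQ_apply]
  have hθ₀inj : Function.Injective θ₀ := by
    rw [← LinearMap.ker_eq_bot, eq_bot_iff]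
    intro y hy
    obtain ⟨x, hx⟩ := LinearMap.mem_range.1 y.2
    have hy' : θ₀ ⟨U x, LinearMap.mem_range_self U x⟩ = 0 := by
      have : (⟨U x, LinearMap.mem_range_self U x⟩ : LinearMap.range U) = y := Subtype.ext hx
      rw [this]
      exact hy
    rw [hθ₀U, hkers] at hy'
    rw [Submodule.mem_bot]
    exact Subtype.ext (by rw [← hx, hy']; rfl)
  have hrange : LinearMap.range θ₀ = LinearMap.range U' := by
    apply le_antisymm
    · rintro _ ⟨y, rfl⟩
      obtain ⟨x, hx⟩ := LinearMap.mem_range.1 y.2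
      have : (⟨U x, LinearMap.mem_range_self U x⟩ : LinearMap.range U) = y := Subtype.ext hx
      rw [← this, hθ₀U]
      obtain ⟨w, hw⟩ := defect_surjective ρ l hSS x
      exact ⟨Submodule.Quotient.mk w, by rw [hU'mk, hw]⟩
    · rintro _ ⟨z, rfl⟩
      obtain ⟨w, rfl⟩ := Submodule.Quotient.mk_surjective _ z
      rw [hU'mk, ← hθ₀U]
      exact LinearMap.mem_range_self θ₀ _
  have hmemr : ∀ y, θ₀ y ∈ LinearMap.range U' := fun y => hrange ▸ LinearMap.mem_range_self θ₀ y
  set θ : LinearMap.range U ≃ₗ[K] LinearMap.range U' :=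
    LinearEquiv.ofBijective (θ₀.codRestrict (LinearMap.range U') hmemr)
      ⟨fun y y' h => hθ₀inj (congrArg Subtype.val h), fun z => by
        obtain ⟨y, hy⟩ := LinearMap.mem_range.1
          (show (z : Space ρ l) ∈ LinearMap.range θ₀ by rw [hrange]; exact z.2)
        exact ⟨y, Subtype.ext hy⟩⟩ with hθ
  have hθapply : ∀ y, (θ y : Space ρ l) = θ₀ y := fun y => rfl
  refine ⟨θ, fun y => Subtype.ext ?_⟩
  obtain ⟨x, hx⟩ := LinearMap.mem_range.1 y.2
  have hy : (⟨U x, LinearMap.mem_range_self U x⟩ : LinearMap.range U) = y := Subtype.ext hx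
  rw [LinearMap.coe_restrict_apply, hθapply, hθapply, ← hy, hθ₀U]
  -- left: `θ₀ ⟨(λA − 1)(U x), _⟩ = θ₀ ⟨U ((λA − 1) x), _⟩ = s ((λA − 1) x)`
  have hcomm : ((l : K) • tuple ρ i - 1) (U x) = U (((l : K) • tuple ρ i - 1) x) := by
    simp only [hU, LinearMap.sub_apply, LinearMap.smul_apply, Module.End.one_apply, map_sub,
      map_smul, smul_sub]
    abel
  have h1 : (⟨((l : K) • tuple ρ i - 1) (U x),
      smul_sub_one_apply_mem_range (tuple ρ i) (l : K) (LinearMap.mem_range_self U x)⟩ :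
        LinearMap.range U) = ⟨U (((l : K) • tuple ρ i - 1) x), LinearMap.mem_range_self U _⟩ :=
    Subtype.ext hcomm
  rw [LinearMap.restrict_apply, h1, hθ₀U, hsapply, hsapply, hU'mk, defect_single_self, hsapply]
  rfl

/-- **Local data of `MC_λ` at the `i`-th puncture** (the numerical content of
[DettweilerReiter2000, Lemma 4.1 (a), Cor. 4.2] used in Cor. 4.4): under `(∗)` and `(∗∗)` at
`(i, λ)`, `rk(Ḡ_i − 1) = rk(A_i − 1)` and
`dim C(Ḡ_i) − (dim ker(Ḡ_i − 1))² = dim C(A_i) − (dim ker(A_i − 1))²`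
(both sides being `dim C_{im(A_i − 1)}(A_i|)` by the peeling lemma and Lemma 4.1 (a)).
[cite: DettweilerReiter2000, Corollary 4.2] -/
theorem centralizerDim_middleConvolution_local [FiniteDimensional K V]
    (hS : (⨅ j ∈ {j | j ≠ i}, LinearMap.ker (tuple ρ j - 1)) ⊓
      LinearMap.ker ((l : K) • tuple ρ i - 1) = ⊥)
    (hSS : (⨆ j ∈ {j | j ≠ i}, LinearMap.range (tuple ρ j - 1)) ⊔
      LinearMap.range ((l : K) • tuple ρ i - 1) = ⊤) :
    finrank K (LinearMap.range (middleConvolution ρ l (FreeGroup.of i) - 1)) =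
        finrank K (LinearMap.range (tuple ρ i - 1)) ∧
      (centralizerDim (middleConvolution ρ l (FreeGroup.of i)) : ℤ) -
          (finrank K (LinearMap.ker (middleConvolution ρ l (FreeGroup.of i) - 1)) : ℤ) ^ 2 =
        (centralizerDim (ρ (FreeGroup.of i)) : ℤ) -
          (finrank K (LinearMap.ker (tuple ρ i - 1)) : ℤ) ^ 2 := by
  obtain ⟨θ, hθ⟩ := exists_rangeEquiv_conj ρ l i hS hSS
  refine ⟨θ.finrank_eq.symm, ?_⟩
  have hAρ : ρ (FreeGroup.of i) = tuple ρ i := rfl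
  set GI : Module.End K (LinearMap.range (middleConvolution ρ l (FreeGroup.of i) - 1)) :=
    (middleConvolution ρ l (FreeGroup.of i) - 1).restrict
      (p := LinearMap.range (middleConvolution ρ l (FreeGroup.of i) - 1))
      (q := LinearMap.range (middleConvolution ρ l (FreeGroup.of i) - 1))
      fun x _ => LinearMap.mem_range_self _ x with hGI
  set AI : Module.End K (LinearMap.range (tuple ρ i - 1)) :=
    (tuple ρ i - 1).restrict (p := LinearMap.range (tuple ρ i - 1))
      (q := LinearMap.range (tuple ρ i - 1)) fun x _ => LinearMap.mem_range_self _ x with hAI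
  set LI : Module.End K (LinearMap.range (tuple ρ i - 1)) :=
    ((l : K) • tuple ρ i - 1).restrict (p := LinearMap.range (tuple ρ i - 1))
      (q := LinearMap.range (tuple ρ i - 1))
      fun _ hx => smul_sub_one_apply_mem_range (tuple ρ i) (l : K) hx with hLI
  -- peeling on both sides
  have hG : centralizerDim (middleConvolution ρ l (FreeGroup.of i)) =
      finrank K (Subalgebra.centralizer K ({GI} : Set _)) +
        finrank K (LinearMap.ker (middleConvolution ρ l (FreeGroup.of i) - 1)) ^ 2 := by
    unfold centralizerDim
    rw [← centralizer_sub_smul_one (1 : K) (middleConvolution ρ l (FreeGroup.of i)), one_smul]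
    exact finrank_centralizer_eq_restrict_add_sq _
  have hA : centralizerDim (tuple ρ i) = finrank K (Subalgebra.centralizer K ({AI} : Set _)) +
      finrank K (LinearMap.ker (tuple ρ i - 1)) ^ 2 := by
    unfold centralizerDim
    rw [← centralizer_sub_smul_one (1 : K) (tuple ρ i), one_smul]
    exact finrank_centralizer_eq_restrict_add_sq _
  -- transport along `θ`, and `LI = λ AI + (λ − 1)`
  have hT : finrank K (Subalgebra.centralizer K ({LI} : Set _)) =
      finrank K (Subalgebra.centralizer K ({GI} : Set _)) :=
    finrank_centralizer_eq_of_conj θ LI GI hθ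
  have hLA : LI = (l : K) • AI + ((l : K) - 1) • 1 := by
    refine LinearMap.ext fun y => Subtype.ext ?_
    simp only [hLI, hAI, LinearMap.coe_restrict_apply, LinearMap.add_apply, LinearMap.smul_apply,
      LinearMap.sub_apply, Module.End.one_apply, Submodule.coe_add, Submodule.coe_smul,
      Submodule.coe_sub, smul_sub, sub_smul, one_smul]
    abel
  have hscal : Subalgebra.centralizer K ({LI} : Set _) =
      Subalgebra.centralizer K ({AI} : Set _) := by
    rw [hLA]
    exact centralizer_smul_add_smul_one (Units.ne_zero l) _ AI
  rw [hAρ, hG, hA]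
  push_cast
  rw [← hT, hscal]
  ring

end LocalStructure

end MiddleConvolution

end Literature.AlgebraicGeometry.Motives

end
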